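import Mathlib

/-!
# Remainder algebra for products of Taylor models (solo-blind s81, engine v3 of the monodromy-box certificate)

Engine v3 of the (MB) certificate composes the step propagators of the cross-leaf chain as
*Taylor models* in the parameter `σ = P - P_c`: a polynomial part `∑_{j ≤ d} σ^j • a_j` with
(ball) coefficients in a normed algebra plus a remainder bound `R` valid on `|σ| ≤ s`.  The dyadic
composition tree, the prefix/suffix propagators and the two-time column models all use one
inequality: the remainder of the truncated product of two Taylor models.  With
`N_A = ∑_{j ≤ d} s^j n_j` (`‖a_j‖ ≤ n_j`), `N_B` likewise and the dropped high part
`T = ∑_{i, i' ≤ d, i + i' > d} s^{i+i'} n_i n'_{i'}`,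
`‖A(σ) B(σ) - trunc_d (p_A p_B)(σ)‖ ≤ N_A R_B + R_A N_B + R_A R_B + T` on `|σ| ≤ s`.
The truncated product is written as the double sum over `i, i' ≤ d` with `i + i' ≤ d` (its
regrouping by total degree gives the Cauchy coefficients the engine stores).

* `taylorModel_poly_norm_le` — `‖∑_{j ≤ d} σ^j • a_j‖ ≤ ∑ s^j n_j` for `|σ| ≤ s`.
* `taylorModel_product_remainder` — the product remainder bound.
-/

namespace Summit.AnomalousDissipation.AnomalousDissipation.Theorems

open Finset

variable {R : Type*} [NormedRing R] [NormedAlgebra ℝ R]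

/-- Norm of the polynomial part of a Taylor model on the disc `|σ| ≤ s`. -/
theorem taylorModel_poly_norm_le (d : ℕ) (a : ℕ → R) (na : ℕ → ℝ) (hna : ∀ j, ‖a j‖ ≤ na j)
    {s σ : ℝ} (hσ : |σ| ≤ s) :
    ‖∑ j ∈ range (d + 1), σ ^ j • a j‖ ≤ ∑ j ∈ range (d + 1), s ^ j * na j := by
  refine (norm_sum_le _ _).trans (sum_le_sum fun j _ => ?_)
  rw [norm_smul, norm_pow, Real.norm_eq_abs]
  exact mul_le_mul (pow_le_pow_left₀ (abs_nonneg σ) hσ j) (hna j) (norm_nonneg _)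
    (pow_nonneg ((abs_nonneg σ).trans hσ) j)

/-- **Product of Taylor models: remainder bound.**  On `|σ| ≤ s`, if `‖A σ - ∑_{j≤d} σ^j • a_j‖ ≤ R_A`
and `‖B σ - ∑_{j≤d} σ^j • b_j‖ ≤ R_B` with coefficient norm bounds `na`, `nb`, then the truncated
double-sum product polynomial approximates `A σ * B σ` within `N_A R_B + R_A N_B + R_A R_B + T`. -/
theorem taylorModel_product_remainder (d : ℕ) (A B : ℝ → R) (a b : ℕ → R) (na nb : ℕ → ℝ)
    (hna : ∀ j, ‖a j‖ ≤ na j) (hnb : ∀ j, ‖b j‖ ≤ nb j) {s RA RB : ℝ} (hRA : 0 ≤ RA)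
    (hA : ∀ σ : ℝ, |σ| ≤ s → ‖A σ - ∑ j ∈ range (d + 1), σ ^ j • a j‖ ≤ RA)
    (hB : ∀ σ : ℝ, |σ| ≤ s → ‖B σ - ∑ j ∈ range (d + 1), σ ^ j • b j‖ ≤ RB)
    {σ : ℝ} (hσ : |σ| ≤ s) :
    ‖A σ * B σ - ∑ i ∈ range (d + 1), ∑ i' ∈ range (d + 1),
        (if i + i' ≤ d then σ ^ (i + i') • (a i * b i') else 0)‖ ≤
      (∑ j ∈ range (d + 1), s ^ j * na j) * RB + RA * (∑ j ∈ range (d + 1), s ^ j * nb j) + RA * RB +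
      ∑ i ∈ range (d + 1), ∑ i' ∈ range (d + 1),
        (if i + i' ≤ d then 0 else s ^ (i + i') * (na i * nb i')) := by
  set pA := ∑ j ∈ range (d + 1), σ ^ j • a j with hpA
  set pB := ∑ j ∈ range (d + 1), σ ^ j • b j with hpB
  set rA := A σ - pA with hrA
  set rB := B σ - pB with hrB
  have hs : 0 ≤ s := (abs_nonneg σ).trans hσ
  have hNA : ‖pA‖ ≤ ∑ j ∈ range (d + 1), s ^ j * na j := taylorModel_poly_norm_le d a na hna hσ
  have hNB : ‖pB‖ ≤ ∑ j ∈ range (d + 1), s ^ j * nb j := taylorModel_poly_norm_le d b nb hnb hσ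
  have hrAle : ‖rA‖ ≤ RA := hA σ hσ
  have hrBle : ‖rB‖ ≤ RB := hB σ hσ
  have hNBnn : 0 ≤ ∑ j ∈ range (d + 1), s ^ j * nb j := le_trans (norm_nonneg _) hNB
  -- the full product of the polynomial parts
  have hprod : pA * pB = ∑ i ∈ range (d + 1), ∑ i' ∈ range (d + 1), σ ^ (i + i') • (a i * b i') := by
    rw [hpA, hpB, sum_mul_sum]
    refine sum_congr rfl fun i _ => sum_congr rfl fun i' _ => ?_
    rw [smul_mul_smul_comm, pow_add]
  -- full product minus truncation = the dropped high part
  have hhigh : pA * pB - ∑ i ∈ range (d + 1), ∑ i' ∈ range (d + 1),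
      (if i + i' ≤ d then σ ^ (i + i') • (a i * b i') else 0) =
      ∑ i ∈ range (d + 1), ∑ i' ∈ range (d + 1),
      (if i + i' ≤ d then 0 else σ ^ (i + i') • (a i * b i')) := by
    rw [hprod, ← sum_sub_distrib]
    refine sum_congr rfl fun i _ => ?_
    rw [← sum_sub_distrib]
    refine sum_congr rfl fun i' _ => ?_
    split_ifs <;> simp
  have hT : ‖pA * pB - ∑ i ∈ range (d + 1), ∑ i' ∈ range (d + 1),
      (if i + i' ≤ d then σ ^ (i + i') • (a i * b i') else 0)‖ ≤
      ∑ i ∈ range (d + 1), ∑ i' ∈ range (d + 1),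
        (if i + i' ≤ d then 0 else s ^ (i + i') * (na i * nb i')) := by
    rw [hhigh]
    refine (norm_sum_le _ _).trans (sum_le_sum fun i _ => (norm_sum_le _ _).trans (sum_le_sum fun i' _ => ?_))
    split_ifs
    · simp
    · rw [norm_smul, norm_pow, Real.norm_eq_abs]
      exact mul_le_mul (pow_le_pow_left₀ (abs_nonneg σ) hσ _) ((norm_mul_le _ _).trans
        (mul_le_mul (hna i) (hnb i') (norm_nonneg _) ((norm_nonneg _).trans (hna i))))
        (norm_nonneg _) (pow_nonneg hs _)
  have hsplit : A σ * B σ - ∑ i ∈ range (d + 1), ∑ i' ∈ range (d + 1),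
      (if i + i' ≤ d then σ ^ (i + i') • (a i * b i') else 0) =
      (pA * pB - ∑ i ∈ range (d + 1), ∑ i' ∈ range (d + 1),
        (if i + i' ≤ d then σ ^ (i + i') • (a i * b i') else 0)) + pA * rB + rA * pB + rA * rB := by
    have hAe : A σ = pA + rA := by rw [hrA]; abel
    have hBe : B σ = pB + rB := by rw [hrB]; abel
    rw [hAe, hBe]; noncomm_ring
  rw [hsplit]
  calc ‖(pA * pB - ∑ i ∈ range (d + 1), ∑ i' ∈ range (d + 1),
        (if i + i' ≤ d then σ ^ (i + i') • (a i * b i') else 0)) + pA * rB + rA * pB + rA * rB‖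
      ≤ ‖pA * pB - ∑ i ∈ range (d + 1), ∑ i' ∈ range (d + 1),
        (if i + i' ≤ d then σ ^ (i + i') • (a i * b i') else 0)‖ + ‖pA * rB‖ + ‖rA * pB‖ + ‖rA * rB‖ := by
          refine (norm_add_le _ _).trans ?_
          refine add_le_add ((norm_add_le _ _).trans (add_le_add (norm_add_le _ _) le_rfl)) le_rfl
    _ ≤ (∑ i ∈ range (d + 1), ∑ i' ∈ range (d + 1),
        (if i + i' ≤ d then 0 else s ^ (i + i') * (na i * nb i'))) +
        (∑ j ∈ range (d + 1), s ^ j * na j) * RB + RA * (∑ j ∈ range (d + 1), s ^ j * nb j) + RA * RB := by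
          have h1 : ‖pA * rB‖ ≤ (∑ j ∈ range (d + 1), s ^ j * na j) * RB :=
            (norm_mul_le _ _).trans (mul_le_mul hNA hrBle (norm_nonneg _) ((norm_nonneg _).trans hNA))
          have h2 : ‖rA * pB‖ ≤ RA * ∑ j ∈ range (d + 1), s ^ j * nb j :=
            (norm_mul_le _ _).trans (mul_le_mul hrAle hNB (norm_nonneg _) hRA)
          have h3 : ‖rA * rB‖ ≤ RA * RB :=
            (norm_mul_le _ _).trans (mul_le_mul hrAle hrBle (norm_nonneg _) hRA)
          linarith [hT]
    _ = _ := by ring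

end Summit.AnomalousDissipation.AnomalousDissipation.Theorems
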